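import Mathlib.Algebra.BigOperators.Ring.Finset
import Mathlib.Algebra.Order.BigOperators.Group.Finset
import Mathlib.Data.Fintype.BigOperators
import Mathlib.Data.Fintype.Pi
import Mathlib.Logic.Equiv.Fin.Basic
import HarnessLib

/-!
# The tribes function (Ben-Or–Linial): exact number of zeros and of pivotal inputs

Topic `Literature/Computability/Complexity` (Boolean function complexity; companion of `KKLTheorem.lean`,
`DecisionTree.lean`).  The TRIBES function of width `w` with `s` tribes (Ben-Or and Linial 1985; O'Donnell,
*Analysis of Boolean Functions*, §4.2) is the read-once DNF

  `Tribes_{w,s}(x) = ⋁_{t < s} ⋀_{j < w} x_{t,j}`   on `s·w` bits indexed by `Fin s × Fin w`.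

It is the standard example showing that the Kahn–Kalai–Linial theorem and the O'Donnell–Saks–Schramm–Servedio
inequality are tight up to constants: with `s = 2^w` (so `n = w·2^w`) it is a roughly balanced function all of whose
influences are `Θ(log n / n)`.  This file proves the two exact counting facts behind those statements, purely
combinatorially (no probability vocabulary):

* `tribes`, `tribes_eq_true_iff`, `tribes_eq_false_iff`;
* `card_filter_tribes_eq_false` — `#{x : Tribes_{w,s}(x) = 0} = (2^w − 1)^s`
  (O'Donnell 2014, §4.2: `Pr[Tribes_{w,s} = False] = (1 − 2^{−w})^s`);
* `tribes_update` — the value after fixing one bit; `tribes_pivotal_iff` — bit `(t₀, j₀)` is pivotal at `x` iff the other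
  `w − 1` bits of tribe `t₀` are `1` and no other tribe is all-`1`;
* `card_filter_tribes_pivotal` — `#{x : (t₀,j₀) pivotal} = 2·(2^w − 1)^{s−1}`
  (O'Donnell 2014, §4.2: `Inf_i[Tribes_{w,s}] = 2^{1−w}(1 − 2^{−w})^{s−1}`), and the cruder
  `card_filter_tribes_pivotal_le` — `#{x : (t₀,j₀) pivotal} ≤ 2·(2^w)^{s−1}`, i.e. `Inf_i ≤ 2^{1−w}`.

Design: the index type is the product `Fin s × Fin w` (tribe, position); users on `Fin (s·w)` transport along
`finProdFinEquiv`.  Pivotality is expressed as `Tribes(x^{(i↦1)}) ≠ Tribes(x^{(i↦0)})`, which does not depend on `x i`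
(`tribes_ne_flip_iff` converts to the flip form `Tribes(x) ≠ Tribes(x ⊕ e_i)`).  Deliberately NOT here: the asymptotics
`(1 − 2^{−w})^{2^w} → 1/e`, Fourier coefficients of tribes, the DNF/decision-tree size of tribes.

## References
* M. Ben-Or, N. Linial, *Collective coin flipping, robust voting schemes and minima of Banzhaf values*, FOCS 1985.
* R. O'Donnell, *Analysis of Boolean Functions*, Cambridge University Press 2014, §4.2 (Tribes).
-/

namespace Literature.Computability.Complexity

open Finset Function

variable {s w : ℕ}

/-- The **tribes function** `Tribes_{w,s}` of width `w` with `s` tribes: the OR over the tribes `t < s` of the AND of the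
`w` bits `x (t, j)`, `j < w` (a read-once monotone DNF on `s·w` bits). [cite: ODonnell2014, §4.2] -/
def tribes (s w : ℕ) (x : Fin s × Fin w → Bool) : Bool :=
  decide (∃ t : Fin s, ∀ j : Fin w, x (t, j) = true)

/-- `Tribes(x) = 1` iff some tribe is all-`1`. [cite: ODonnell2014, §4.2] -/
theorem tribes_eq_true_iff (x : Fin s × Fin w → Bool) :
    tribes s w x = true ↔ ∃ t : Fin s, ∀ j : Fin w, x (t, j) = true := by
  simp [tribes]

/-- `Tribes(x) = 0` iff every tribe contains a `0`. [cite: ODonnell2014, §4.2] -/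
theorem tribes_eq_false_iff (x : Fin s × Fin w → Bool) :
    tribes s w x = false ↔ ∀ t : Fin s, ∃ j : Fin w, x (t, j) = false := by
  rw [← Bool.not_eq_true, tribes_eq_true_iff]
  push Not
  simp only [Bool.not_eq_true]

/-! ### Counting through the curried picture `Fin s → (Fin w → Bool)` -/

/-- The number of `w`-bit strings that are not all-`1` is `2^w − 1` (private counting helper). [folklore] -/
private theorem card_erase_allTrue (w : ℕ) :
    ((Finset.univ : Finset (Fin w → Bool)).erase (fun _ => true)).card = 2 ^ w - 1 := by
  rw [Finset.card_erase_of_mem (Finset.mem_univ _), Finset.card_univ, Fintype.card_fun, Fintype.card_bool,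
    Fintype.card_fin]

/-- A `w`-bit string is not all-`1` iff it has a `0` (private helper). [folklore] -/
private theorem ne_allTrue_iff (z : Fin w → Bool) : z ≠ (fun _ => true) ↔ ∃ j, z j = false := by
  rw [Ne, funext_iff]
  push Not
  simp only [Bool.not_eq_true]

/-- The `w`-bit strings whose bits other than `j₀` are all `1` are exactly the all-`1` string and the string with a single
`0` at `j₀`; there are `2` of them (private counting helper). [folklore] -/
private theorem card_filter_others_true (j₀ : Fin w) :
    ((Finset.univ : Finset (Fin w → Bool)).filter (fun z => ∀ j, j ≠ j₀ → z j = true)).card = 2 := by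
  have hne : (fun _ : Fin w => true) ≠ update (fun _ : Fin w => true) j₀ false := by
    intro h
    have := congrFun h j₀
    rw [update_self] at this
    exact Bool.noConfusion this
  rw [← Finset.card_pair hne]
  congr 1
  ext z
  simp only [Finset.mem_filter, Finset.mem_univ, true_and, Finset.mem_insert, Finset.mem_singleton]
  constructor
  · intro h
    rcases Bool.eq_false_or_eq_true (z j₀) with h0 | h0
    · left
      funext j
      by_cases hj : j = j₀
      · rw [hj, h0]
      · exact h j hj
    · right
      funext j
      by_cases hj : j = j₀
      · rw [hj, h0, update_self]
      · rw [update_of_ne hj, h j hj]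
  · rintro (rfl | rfl) j hj
    · rfl
    · rw [update_of_ne hj]

/-- **`Pr[Tribes_{w,s} = 0] = (1 − 2^{−w})^s`, counting form:** the number of inputs on which the tribes function is `0` is
`(2^w − 1)^s` (each of the `s` tribes independently avoids the all-`1` string). [cite: ODonnell2014, §4.2] -/
theorem card_filter_tribes_eq_false (s w : ℕ) :
    ((Finset.univ : Finset (Fin s × Fin w → Bool)).filter (fun x => tribes s w x = false)).card = (2 ^ w - 1) ^ s := by
  classical
  -- pass to the curried picture
  have h1 : ((Finset.univ : Finset (Fin s × Fin w → Bool)).filter (fun x => tribes s w x = false)).card =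
      ((Finset.univ : Finset (Fin s → Fin w → Bool)).filter (fun y => ∀ t, ∃ j, y t j = false)).card := by
    rw [← Fintype.card_subtype, ← Fintype.card_subtype]
    refine Fintype.card_congr ((Equiv.curry (Fin s) (Fin w) Bool).subtypeEquiv fun x => ?_)
    rw [tribes_eq_false_iff]
    rfl
  have h2 : (Finset.univ : Finset (Fin s → Fin w → Bool)).filter (fun y => ∀ t, ∃ j, y t j = false) =
      Fintype.piFinset fun _ : Fin s => (Finset.univ : Finset (Fin w → Bool)).erase (fun _ => true) := by
    ext y
    simp only [Finset.mem_filter, Finset.mem_univ, true_and, Fintype.mem_piFinset, Finset.mem_erase, and_true,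
      ne_allTrue_iff]
  rw [h1, h2, Fintype.card_piFinset, Finset.prod_const, card_erase_allTrue, Finset.card_univ, Fintype.card_fin]

/-- Complement count: `#{x : Tribes_{w,s}(x) = 1} = 2^{s w} − (2^w − 1)^s`. [cite: ODonnell2014, §4.2] -/
theorem card_filter_tribes_eq_true (s w : ℕ) :
    ((Finset.univ : Finset (Fin s × Fin w → Bool)).filter (fun x => tribes s w x = true)).card =
      2 ^ (s * w) - (2 ^ w - 1) ^ s := by
  classical
  have h := Finset.card_filter_add_card_filter_not
    (s := (Finset.univ : Finset (Fin s × Fin w → Bool))) (fun x => tribes s w x = true)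
  have hneg : ((Finset.univ : Finset (Fin s × Fin w → Bool)).filter (fun x => ¬ tribes s w x = true)).card =
      (2 ^ w - 1) ^ s := by
    rw [← card_filter_tribes_eq_false s w]
    congr 1
    ext x
    simp only [Finset.mem_filter, Finset.mem_univ, true_and, Bool.not_eq_true]
  rw [hneg, Finset.card_univ, Fintype.card_fun, Fintype.card_bool, Fintype.card_prod, Fintype.card_fin,
    Fintype.card_fin] at h
  omega

/-! ### Pivotal inputs -/

/-- The value of tribes after FIXING bit `(t₀, j₀)` to `b`: tribe `t₀` is all-`1` iff `b = 1` and its other bits are `1`;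
the other tribes are untouched. [cite: ODonnell2014, §4.2] -/
theorem tribes_update (x : Fin s × Fin w → Bool) (t₀ : Fin s) (j₀ : Fin w) (b : Bool) :
    tribes s w (update x (t₀, j₀) b) = true ↔
      (b = true ∧ ∀ j, j ≠ j₀ → x (t₀, j) = true) ∨ ∃ t, t ≠ t₀ ∧ ∀ j, x (t, j) = true := by
  rw [tribes_eq_true_iff]
  constructor
  · rintro ⟨t, ht⟩
    by_cases htt : t = t₀
    · subst htt
      left
      refine ⟨?_, fun j hj => ?_⟩
      · have := ht j₀
        rwa [update_self] at this
      · have := ht j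
        rwa [update_of_ne (fun h => hj (Prod.mk.inj h).2)] at this
    · right
      refine ⟨t, htt, fun j => ?_⟩
      have := ht j
      rwa [update_of_ne (fun h => htt (Prod.mk.inj h).1)] at this
  · rintro (⟨hb, hA⟩ | ⟨t, htt, ht⟩)
    · refine ⟨t₀, fun j => ?_⟩
      by_cases hj : j = j₀
      · rw [hj, update_self, hb]
      · rw [update_of_ne (fun h => hj (Prod.mk.inj h).2)]
        exact hA j hj
    · refine ⟨t, fun j => ?_⟩
      rw [update_of_ne (fun h => htt (Prod.mk.inj h).1)]
      exact ht j

/-- **Pivotality for tribes.** Bit `(t₀, j₀)` is pivotal at `x` (the value of tribes depends on it) iff the other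
`w − 1` bits of tribe `t₀` are `1` and no other tribe is all-`1`. [cite: ODonnell2014, §4.2] -/
theorem tribes_pivotal_iff (x : Fin s × Fin w → Bool) (t₀ : Fin s) (j₀ : Fin w) :
    tribes s w (update x (t₀, j₀) true) ≠ tribes s w (update x (t₀, j₀) false) ↔
      (∀ j, j ≠ j₀ → x (t₀, j) = true) ∧ ∀ t, t ≠ t₀ → ∃ j, x (t, j) = false := by
  have h1 := tribes_update x t₀ j₀ true
  have h0 := tribes_update x t₀ j₀ false
  simp only [true_and] at h1
  simp only [Bool.false_eq_true, false_and, false_or] at h0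
  -- abbreviate the two propositions
  set A : Prop := ∀ j, j ≠ j₀ → x (t₀, j) = true with hA
  set R : Prop := ∃ t, t ≠ t₀ ∧ ∀ j, x (t, j) = true with hR
  have hR' : (∀ t, t ≠ t₀ → ∃ j, x (t, j) = false) ↔ ¬ R := by
    rw [hR]
    push Not
    simp only [Bool.not_eq_true]
  rw [hR']
  constructor
  · intro hne
    by_cases hr : R
    · exact absurd ((h1.mpr (Or.inr hr)).trans (h0.mpr hr).symm) hne
    · refine ⟨?_, hr⟩
      by_contra hA'
      have ht : tribes s w (update x (t₀, j₀) true) = false := by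
        rw [← Bool.not_eq_true, h1]
        rintro (h | h)
        · exact hA' h
        · exact hr h
      have hf : tribes s w (update x (t₀, j₀) false) = false := by
        rw [← Bool.not_eq_true, h0]
        exact hr
      exact hne (ht.trans hf.symm)
  · rintro ⟨hA', hr⟩ heq
    have ht : tribes s w (update x (t₀, j₀) true) = true := h1.mpr (Or.inl hA')
    rw [heq, h0] at ht
    exact hr ht

/-- The flip form of pivotality (O'Donnell's Def. 2.13: `i` is pivotal at `x` iff `f(x) ≠ f(x^{⊕i})`):
`Tribes(x) ≠ Tribes(x ⊕ e_i)` iff `Tribes(x^{(i↦1)}) ≠ Tribes(x^{(i↦0)})`. [cite: ODonnell2014, Def. 2.13] -/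
theorem tribes_ne_flip_iff (x : Fin s × Fin w → Bool) (i : Fin s × Fin w) :
    tribes s w x ≠ tribes s w (update x i (!x i)) ↔ tribes s w (update x i true) ≠ tribes s w (update x i false) := by
  rcases Bool.eq_false_or_eq_true (x i) with hx | hx
  · have hu : update x i true = x := by rw [← hx]; exact update_eq_self i x
    rw [hu, hx, Bool.not_true]
  · have hu : update x i false = x := by rw [← hx]; exact update_eq_self i x
    rw [hu, hx, Bool.not_false, ne_comm]

/-- **`Inf_i[Tribes_{w,s}] = 2^{1−w}(1 − 2^{−w})^{s−1}`, counting form:** for `s ≥ 1` the number of inputs at which bit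
`(t₀, j₀)` is pivotal is `2·(2^w − 1)^{s−1}` (bit `(t₀,j₀)` itself is free, the other bits of tribe `t₀` are `1`, each
other tribe avoids all-`1`; `s ≥ 1` is automatic from `t₀ : Fin s`). [cite: ODonnell2014, §4.2] -/
theorem card_filter_tribes_pivotal (t₀ : Fin s) (j₀ : Fin w) :
    ((Finset.univ : Finset (Fin s × Fin w → Bool)).filter
        (fun x => tribes s w (update x (t₀, j₀) true) ≠ tribes s w (update x (t₀, j₀) false))).card =
      2 * (2 ^ w - 1) ^ (s - 1) := by
  classical
  have h1 : ((Finset.univ : Finset (Fin s × Fin w → Bool)).filter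
        (fun x => tribes s w (update x (t₀, j₀) true) ≠ tribes s w (update x (t₀, j₀) false))).card =
      ((Finset.univ : Finset (Fin s → Fin w → Bool)).filter
        (fun y => (∀ j, j ≠ j₀ → y t₀ j = true) ∧ ∀ t, t ≠ t₀ → ∃ j, y t j = false)).card := by
    rw [← Fintype.card_subtype, ← Fintype.card_subtype]
    refine Fintype.card_congr ((Equiv.curry (Fin s) (Fin w) Bool).subtypeEquiv fun x => ?_)
    rw [tribes_pivotal_iff]
    rfl
  have h2 : (Finset.univ : Finset (Fin s → Fin w → Bool)).filter
        (fun y => (∀ j, j ≠ j₀ → y t₀ j = true) ∧ ∀ t, t ≠ t₀ → ∃ j, y t j = false) =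
      Fintype.piFinset fun t : Fin s =>
        if t = t₀ then (Finset.univ : Finset (Fin w → Bool)).filter (fun z => ∀ j, j ≠ j₀ → z j = true)
        else (Finset.univ : Finset (Fin w → Bool)).erase (fun _ => true) := by
    ext y
    simp only [Finset.mem_filter, Finset.mem_univ, true_and, Fintype.mem_piFinset]
    constructor
    · rintro ⟨hA, hR⟩ t
      by_cases ht : t = t₀
      · subst ht
        rw [if_pos rfl, Finset.mem_filter]
        exact ⟨Finset.mem_univ _, hA⟩
      · rw [if_neg ht, Finset.mem_erase, ne_allTrue_iff]
        exact ⟨hR t ht, Finset.mem_univ _⟩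
    · intro h
      refine ⟨?_, fun t ht => ?_⟩
      · have := h t₀
        rw [if_pos rfl, Finset.mem_filter] at this
        exact this.2
      · have := h t
        rw [if_neg ht, Finset.mem_erase, ne_allTrue_iff] at this
        exact this.1
  rw [h1, h2, Fintype.card_piFinset]
  rw [← Finset.mul_prod_erase Finset.univ _ (Finset.mem_univ t₀), if_pos rfl, card_filter_others_true]
  congr 1
  rw [Finset.prod_congr rfl fun t ht => by rw [if_neg (Finset.ne_of_mem_erase ht), card_erase_allTrue]]
  rw [Finset.prod_const, Finset.card_erase_of_mem (Finset.mem_univ _), Finset.card_univ, Fintype.card_fin]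

/-- **Every influence of tribes is at most `2^{1−w}`, counting form:** the inputs at which bit `(t₀, j₀)` is pivotal
number at most `2·(2^w)^{s−1}` (drop the condition on the other tribes; `s ≥ 1` is automatic from `t₀ : Fin s`).
[cite: ODonnell2014, §4.2] -/
theorem card_filter_tribes_pivotal_le (t₀ : Fin s) (j₀ : Fin w) :
    ((Finset.univ : Finset (Fin s × Fin w → Bool)).filter
        (fun x => tribes s w (update x (t₀, j₀) true) ≠ tribes s w (update x (t₀, j₀) false))).card ≤
      2 * (2 ^ w) ^ (s - 1) := by
  rw [card_filter_tribes_pivotal]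
  exact Nat.mul_le_mul_left 2 (Nat.pow_le_pow_left (Nat.sub_le _ _) _)

/-- The pivotal count in the flip form `Tribes(x) ≠ Tribes(x ⊕ e_i)`: also `2·(2^w − 1)^{s−1}`.
[cite: ODonnell2014, §4.2] -/
theorem card_filter_tribes_ne_flip (i : Fin s × Fin w) :
    ((Finset.univ : Finset (Fin s × Fin w → Bool)).filter
        (fun x => tribes s w x ≠ tribes s w (update x i (!x i)))).card = 2 * (2 ^ w - 1) ^ (s - 1) := by
  obtain ⟨t₀, j₀⟩ := i
  rw [← card_filter_tribes_pivotal t₀ j₀]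
  congr 1
  ext x
  simp only [Finset.mem_filter, Finset.mem_univ, true_and]
  exact tribes_ne_flip_iff x (t₀, j₀)

end Literature.Computability.Complexity
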